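import Summits.CriticalPhenomena.CardyFormulaZ2.Theorems.CardyComplexConeEdgePrecompactChainAt
import Summits.CriticalPhenomena.CardyFormulaZ2.Theorems.CardyComplexConeEdgePrecompactTranslationCovariance
import Summits.CriticalPhenomena.CardyFormulaZ2.Theorems.CardyComplexConeEdgePrecompactEnvelopeFromLocal
import Literature.Probability.LatticeModels.MedialWindingBridge

/-!
# The line's composition PER DOMAIN: `EdgePrecompact` at `D` from X1 and UFRS at `D`
(line `qkz-strip-boundary-arm` of crux `CardyComplexCone.EdgePrecompact`, stmt-CriticalPhenomena-11387; lead c4;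
registered sub-goals `EdgePrecompact_at_of_X1_of_ufrsAt` and `EdgePrecompact_rect_of_X1_of_ufrsRect`)

The skeleton's composition `EdgePrecompact_of` feeds the two registered stubs X1 (`stub_localInnerEnvelopeUI`) and
UFRS (`stub_uniformForwardResponseStability`, quantified over ALL Jordan Dobrushin domains) through the landed chain
`forwardResponseStability_of_uniformForwardResponseStability`, `responseStability_of_forwardResponseStability`,
`hullStability_of_responseStability`, `shiftCouplingLocality_of_hullStability`, `shiftStability_of`,
`equicontClause`, `boundClause`. Every one of these reductions is POINTWISE IN THE DOMAIN (each applies its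
hypothesis at the same `D`). This file records the per-domain forms (`…_at`, proofs copied verbatim with `D`
fixed) and the resulting compositions:

* `EdgePrecompact_at_of_X1_of_ufrsAt D : X1 → (UFRS at D) → (EdgePrecompact at D)`;
* `EdgePrecompact_rect_of_X1_of_ufrsRect : X1 → (UFRS for axis-parallel rectangles, the registered sub-goal
  `ufrs_rect` of wave 3) → (EdgePrecompact for every Dobrushin domain whose carrier is an open axis-parallel
  rectangle)`.

So for rectangles the crux is EXACTLY X1 + `ufrs_rect` (phase-free, RSW/arm technology on a flat boundary);
for general Jordan domains it is X1 + UFRS, whose only non-flat ingredient is the screened collar three-arm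
decay `ufrs_screenedCollarDecay` (not in print). X1 itself is research-open and certified hard
(`halfPlaneArm_cubeRoot_of_localInnerEnvelopeUI`).
-/

namespace Summit.CriticalPhenomena.CardyFormulaZ2.Cruxes.EdgePrecompact.QkzStripBoundaryArm

open MeasureTheory Filter Set Metric ProbabilityTheory
open scoped Topology BigOperators Pointwise
open Literature.Probability.LatticeModels Literature.Probability.Percolation
open Literature.Probability.RandomPlanarGeometry (DobrushinDomain)
open Summit.CriticalPhenomena.CardyFormulaZ2.Theses.CardyComplexCone


noncomputable section

/-! ## Shift stability at `D` -/

/-- Per-domain form of `shiftStability_of` (X1 + shift-coupling locality at `D` ⇒ shift stability at `D`). -/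
theorem shiftStability_at (D : DobrushinDomain) :
    (∀ ε₁ > (0:ℝ), ∃ ε' > (0:ℝ), ∀ (E : DiscreteDobrushin), E.IsZdAdmissible →
      ∀ v f : Site 2, IsCorner v f → ∀ ρ : ℝ, E.δ ≤ ρ → closedBall (meshPoint E.δ v) ρ ⊆ E.Ω →
      ∀ A : Set (BondConfig (Site 2)),
        MeasurableSet[MeasurableSpace.comap
          (fun ω : BondConfig (Site 2) => ω \ {e | medialPoint E.δ e ∈ ball (meshPoint E.δ v) ρ})
          (inferInstance : MeasurableSpace (BondConfig (Site 2)))] A →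
        (bondPercolation (zdGraph 2) half).real A ≤ ε' →
        ‖∫ ω in A, dartPhaseSum (medialExploration E ω) E.δ (1 / 3) (v, f)
          ∂(bondPercolation (zdGraph 2) half)‖ ≤ ε₁ * (E.δ / ρ) ^ ((1:ℝ) / 3)) →
    (∀ (Λ : ℝ → DiscreteDobrushin),
      (∀ δ, (Λ δ).Ω = D.carrier) → (∀ δ, (Λ δ).δ = δ) →
      (∀ᶠ δ in nhdsWithin (0:ℝ) (Set.Ioi 0), (Λ δ).IsZdAdmissible) →
      ∀ K : Set ℂ, IsCompact K → K ⊆ D.carrier →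
      ∀ ρ > (0:ℝ), cthickening (2 * ρ) K ⊆ D.carrier →
      ∀ ε > (0:ℝ), ∃ η > (0:ℝ), ∀ᶠ δ in nhdsWithin (0:ℝ) (Set.Ioi 0), ∀ v f w : Site 2,
        IsCorner v f → meshPoint δ v ∈ K → ‖meshPoint δ w‖ < η →
        ∃ B : Set (BondConfig (Site 2)),
          MeasurableSet[MeasurableSpace.comap
            (fun ω : BondConfig (Site 2) => ω \ {e | medialPoint δ e ∈ ball (meshPoint δ v) ρ})
            (inferInstance : MeasurableSpace (BondConfig (Site 2)))] B ∧
          (bondPercolation (zdGraph 2) half).real B ≤ ε ∧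
          (∫ ω, dartPhaseSum (medialExploration (Λ δ) ω) δ (1 / 3) (v, f)
              ∂(bondPercolation (zdGraph 2) half)) -
            (∫ ω, dartPhaseSum (medialExploration (shiftData (Λ δ) w) ω) δ (1 / 3) (v, f)
              ∂(bondPercolation (zdGraph 2) half)) =
          (∫ ω in B, dartPhaseSum (medialExploration (Λ δ) ω) δ (1 / 3) (v, f)
              ∂(bondPercolation (zdGraph 2) half)) -
            (∫ ω in B, dartPhaseSum (medialExploration (shiftData (Λ δ) w) ω) δ (1 / 3) (v, f)
              ∂(bondPercolation (zdGraph 2) half))) →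
    (∀ (Λ : ℝ → DiscreteDobrushin),
    (∀ δ, (Λ δ).Ω = D.carrier) → (∀ δ, (Λ δ).δ = δ) →
    (∀ᶠ δ in 𝓝[>] (0:ℝ), (Λ δ).IsZdAdmissible) →
    ∀ K : Set ℂ, IsCompact K → K ⊆ D.carrier → ∀ ε > (0:ℝ), ∃ η > (0:ℝ), ∀ᶠ δ in 𝓝[>] (0:ℝ),
    ∀ v f w : Site 2, IsCorner v f → meshPoint δ v ∈ K → meshPoint δ (v + w) ∈ K →
    dist (meshPoint δ v) (meshPoint δ (v + w)) < η →
    ‖cornerObs (Λ δ) δ v f - cornerObs (shiftData (Λ δ) (-w)) δ v f‖ ≤ ε * δ ^ ((1:ℝ) / 3)) := by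
  intro hUI hSCL Λ hΩ hδ hadm K hK hKD ε hε
  -- a uniform inner radius for `K` (interiority of `K` is load-bearing)
  obtain ⟨r, hr, hrK⟩ := hK.exists_cthickening_subset_open D.isOpen hKD
  set ρ : ℝ := r / 2 with hρdef
  have hρ : 0 < ρ := by positivity
  have h2ρ : 2 * ρ = r := by rw [hρdef]; ring
  have hρK : cthickening (2 * ρ) K ⊆ D.carrier := by rw [h2ρ]; exact hrK
  have hρK' : cthickening ρ K ⊆ D.carrier := (cthickening_mono (by linarith) K).trans hρK
  have hpos : ∀ᶠ δ in 𝓝[>] (0:ℝ), 0 < δ := eventually_mem_nhdsWithin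
  have hlt : ∀ᶠ δ in 𝓝[>] (0:ℝ), δ < ρ := (eventually_lt_nhds hρ).filter_mono nhdsWithin_le_nhds
  have hρ3 : 0 < ρ ^ ((1:ℝ) / 3) := Real.rpow_pos_of_pos hρ _
  have hballK : ∀ (δ : ℝ) (v : Site 2), meshPoint δ v ∈ K →
      closedBall (meshPoint δ v) ρ ⊆ D.carrier := fun δ v hvK x hx =>
    hρK' (mem_cthickening_of_dist_le x (meshPoint δ v) ρ K hvK (mem_closedBall.1 hx))
  -- constants
  set ε₁ : ℝ := ε * ρ ^ ((1:ℝ) / 3) / 2 with hε₁def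
  have hε₁ : 0 < ε₁ := by positivity
  obtain ⟨ε', hε', hC⟩ := hUI ε₁ hε₁
  obtain ⟨η, hη, hev⟩ := hSCL Λ hΩ hδ hadm K hK hKD ρ hρ hρK ε' hε'
  refine ⟨min η ρ, lt_min hη hρ, ?_⟩
  filter_upwards [hev, hadm, hpos, hlt] with δ hevδ hadmδ hδpos hδρ
  intro v f w hvf hvK _hvwK hdist
  have hΛδ : (Λ δ).δ = δ := hδ δ
  -- the data are shifted by `u := -w`, `‖δu‖ = dist (δv) (δ(v+w)) < min η ρ`
  have hnormu : ‖meshPoint δ (-w)‖ < min η ρ := by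
    have : meshPoint δ (-w) = meshPoint δ v - meshPoint δ (v + w) := by
      rw [meshPoint_neg, meshPoint_add_shift]; ring
    rw [this, ← dist_eq_norm]; exact hdist
  have hηu : ‖meshPoint δ (-w)‖ < η := lt_of_lt_of_le hnormu (min_le_left _ _)
  have hρu : ‖meshPoint δ (-w)‖ < ρ := lt_of_lt_of_le hnormu (min_le_right _ _)
  -- (X2): the difference is carried by an exterior-measurable event `B` of probability `≤ ε'`
  obtain ⟨B, hBmeas, hBprob, hBdiff⟩ := hevδ v f (-w) hvf hvK hηu
  -- (X1) on `B` for the datum `Λ δ` …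
  have key₀ := hC (Λ δ) hadmδ v f hvf ρ (by rw [hΛδ]; exact hδρ.le)
    (by rw [hΛδ, hΩ]; exact hballK δ v hvK) B (by rw [hΛδ]; exact hBmeas) hBprob
  rw [hΛδ] at key₀
  -- … and for the translated datum (admissible by transport; its ball lies in `D + δ(-w)`)
  have hδT : (shiftData (Λ δ) (-w)).δ = δ := hΛδ
  have hball₁ : closedBall (meshPoint δ v) ρ ⊆ (shiftData (Λ δ) (-w)).Ω := by
    intro x hx
    rw [shiftData_Ω, hΩ, hΛδ]
    refine Set.mem_vadd_set.2 ⟨x - meshPoint δ (-w), ?_, by simp⟩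
    apply hρK
    refine mem_cthickening_of_dist_le (x - meshPoint δ (-w)) (meshPoint δ v) (2 * ρ) K hvK ?_
    calc dist (x - meshPoint δ (-w)) (meshPoint δ v)
        ≤ dist (x - meshPoint δ (-w)) x + dist x (meshPoint δ v) := dist_triangle _ _ _
      _ = ‖meshPoint δ (-w)‖ + dist x (meshPoint δ v) := by
          rw [dist_eq_norm]; congr 1; simp
      _ ≤ ρ + ρ := add_le_add hρu.le (mem_closedBall.1 hx)
      _ = 2 * ρ := by ring
  have key₁ := hC (shiftData (Λ δ) (-w)) (isZdAdmissible_shiftData _ _ hadmδ) v f hvf ρ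
    (by rw [hδT]; exact hδρ.le) (by rw [hδT]; exact hball₁) B (by rw [hδT]; exact hBmeas) hBprob
  rw [hδT] at key₁
  -- assemble: the corner observables are the full expectations of the two phase sums
  rw [cornerObs_eq_integral_dartPhaseSum, cornerObs_eq_integral_dartPhaseSum, hBdiff]
  have hsplit : (δ / ρ) ^ ((1:ℝ) / 3) = δ ^ ((1:ℝ) / 3) / ρ ^ ((1:ℝ) / 3) :=
    Real.div_rpow hδpos.le hρ.le _
  calc ‖(∫ ω in B, dartPhaseSum (medialExploration (Λ δ) ω) δ (1 / 3) (v, f)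
            ∂(bondPercolation (zdGraph 2) half)) -
          (∫ ω in B, dartPhaseSum (medialExploration (shiftData (Λ δ) (-w)) ω) δ (1 / 3) (v, f)
            ∂(bondPercolation (zdGraph 2) half))‖
      ≤ ‖∫ ω in B, dartPhaseSum (medialExploration (Λ δ) ω) δ (1 / 3) (v, f)
            ∂(bondPercolation (zdGraph 2) half)‖ +
          ‖∫ ω in B, dartPhaseSum (medialExploration (shiftData (Λ δ) (-w)) ω) δ (1 / 3) (v, f)
            ∂(bondPercolation (zdGraph 2) half)‖ := norm_sub_le _ _
    _ ≤ ε₁ * (δ / ρ) ^ ((1:ℝ) / 3) + ε₁ * (δ / ρ) ^ ((1:ℝ) / 3) := add_le_add key₀ key₁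
    _ = ε * δ ^ ((1:ℝ) / 3) := by
        rw [hsplit, hε₁def]
        field_simp
        ring

/-! ## The skeleton glue, per domain -/

/-- **Clause (i) of the crux at `D` from the uniform inner envelope, by compactness** (verbatim the skeleton's
`boundClause`; this is where the interiority of `K` enters: lattice depth `≥ dist(K, Dᶜ)/δ → ∞`). -/
theorem boundClause_at (hU : UniformInnerEnvelope) (D : DobrushinDomain) (Λ : ℝ → DiscreteDobrushin)
    (hΩ : ∀ δ, (Λ δ).Ω = D.carrier) (hδ : ∀ δ, (Λ δ).δ = δ)
    (hadm : ∀ᶠ δ in 𝓝[>] (0:ℝ), (Λ δ).IsZdAdmissible) (K : Set ℂ) (hK : IsCompact K)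
    (hKD : K ⊆ D.carrier) :
    ∃ C : ℝ, ∀ᶠ δ in 𝓝[>] (0:ℝ), ∀ v f : Site 2, IsCorner v f → meshPoint δ v ∈ K →
      ‖cornerObs (Λ δ) δ v f‖ ≤ C * δ ^ ((1:ℝ) / 3) := by
  obtain ⟨C, hC⟩ := hU
  obtain ⟨ρ, hρ, hρD⟩ := hK.exists_thickening_subset_open D.isOpen hKD
  refine ⟨max C 0 * (2 / ρ) ^ ((1:ℝ) / 3), ?_⟩
  have hsmall : ∀ᶠ δ in 𝓝[>] (0:ℝ), δ ∈ Ioo (0:ℝ) (ρ / 2) := Ioo_mem_nhdsGT (by positivity)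
  filter_upwards [hadm, hsmall] with δ hδadm hδI
  obtain ⟨hδ0, hδρ⟩ := hδI
  intro v f hvf hvK
  -- the complement of the domain is nonempty and at distance ≥ ρ from the corner
  have hDc : D.carrierᶜ.Nonempty := by
    obtain ⟨y, hy⟩ := (Set.ne_univ_iff_exists_notMem _).1 D.toJordanDomain.carrier_ne_univ
    exact ⟨y, hy⟩
  have hdist : ρ ≤ infDist (meshPoint δ v) D.carrierᶜ := by
    rw [le_infDist hDc]
    intro y hy
    by_contra hlt
    have hlt' : dist (meshPoint δ v) y < ρ := lt_of_not_ge hlt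
    have hyb : y ∈ ball (meshPoint δ v) ρ := by
      rw [mem_ball, dist_comm]; exact hlt'
    exact hy (hρD (ball_subset_thickening hvK ρ hyb))
  -- the lattice depth R = ⌊ρ/δ⌋
  obtain ⟨R, hR⟩ : ∃ R : ℕ, R = ⌊ρ / δ⌋₊ := ⟨_, rfl⟩
  have hρδ : 2 ≤ ρ / δ := by
    rw [le_div_iff₀ hδ0]; linarith
  have hR1 : 1 ≤ R := by
    rw [hR]
    exact Nat.floor_pos.2 (by linarith)
  have hRle : (R : ℝ) * δ ≤ ρ := by
    have : (R : ℝ) ≤ ρ / δ := by rw [hR]; exact Nat.floor_le (by positivity)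
    rwa [le_div_iff₀ hδ0] at this
  have hRge : ρ / (2 * δ) ≤ (R : ℝ) := by
    have hlt : ρ / δ < (R : ℝ) + 1 := by rw [hR]; exact Nat.lt_floor_add_one _
    have hhalf : ρ / δ = 2 * (ρ / (2 * δ)) := by field_simp
    linarith
  have hx : 0 < ρ / (2 * δ) := by positivity
  -- the envelope at depth R
  have hE : (Λ δ).δ = δ := hδ δ
  have h := hC D (Λ δ) (hΩ δ) hδadm v f hvf R hR1 (by rw [hE]; exact le_trans hRle hdist)
  rw [hE] at h
  -- R^{-1/3} ≤ (ρ/(2δ))^{-1/3} = (2/ρ)^{1/3} δ^{1/3}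
  have hexp : (-(1:ℝ) / 3) ≤ 0 := by norm_num
  have hmono : (R : ℝ) ^ (-(1:ℝ) / 3) ≤ (ρ / (2 * δ)) ^ (-(1:ℝ) / 3) :=
    Real.rpow_le_rpow_of_nonpos hx hRge hexp
  have hpow : (ρ / (2 * δ)) ^ (-(1:ℝ) / 3) = (2 / ρ) ^ ((1:ℝ) / 3) * δ ^ ((1:ℝ) / 3) := by
    calc (ρ / (2 * δ)) ^ (-(1:ℝ) / 3) = ((ρ / (2 * δ)) ^ ((1:ℝ) / 3))⁻¹ := by
            rw [show (-(1:ℝ) / 3) = -((1:ℝ) / 3) by ring, Real.rpow_neg hx.le]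
      _ = ((ρ / (2 * δ))⁻¹) ^ ((1:ℝ) / 3) := (Real.inv_rpow hx.le _).symm
      _ = ((2 / ρ) * δ) ^ ((1:ℝ) / 3) := by rw [inv_div]; ring_nf
      _ = (2 / ρ) ^ ((1:ℝ) / 3) * δ ^ ((1:ℝ) / 3) := Real.mul_rpow (by positivity) hδ0.le
  have hr0 : 0 ≤ (R : ℝ) ^ (-(1:ℝ) / 3) := Real.rpow_nonneg (by positivity) _
  calc ‖cornerObs (Λ δ) δ v f‖ ≤ C * (R : ℝ) ^ (-(1:ℝ) / 3) := h
    _ ≤ max C 0 * (R : ℝ) ^ (-(1:ℝ) / 3) := mul_le_mul_of_nonneg_right (le_max_left _ _) hr0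
    _ ≤ max C 0 * (ρ / (2 * δ)) ^ (-(1:ℝ) / 3) := mul_le_mul_of_nonneg_left hmono (le_max_right _ _)
    _ = max C 0 * (2 / ρ) ^ ((1:ℝ) / 3) * δ ^ ((1:ℝ) / 3) := by rw [hpow]; ring

/-- **Clause (ii) of the crux at the domain `D` from translation covariance + shift stability at `D`** (per-domain form of the skeleton's `equicontClause`). -/
theorem equicontClause_at (D : DobrushinDomain) (hS : (∀ (Λ : ℝ → DiscreteDobrushin),
    (∀ δ, (Λ δ).Ω = D.carrier) → (∀ δ, (Λ δ).δ = δ) →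
    (∀ᶠ δ in 𝓝[>] (0:ℝ), (Λ δ).IsZdAdmissible) →
    ∀ K : Set ℂ, IsCompact K → K ⊆ D.carrier → ∀ ε > (0:ℝ), ∃ η > (0:ℝ), ∀ᶠ δ in 𝓝[>] (0:ℝ),
    ∀ v f w : Site 2, IsCorner v f → meshPoint δ v ∈ K → meshPoint δ (v + w) ∈ K →
    dist (meshPoint δ v) (meshPoint δ (v + w)) < η →
    ‖cornerObs (Λ δ) δ v f - cornerObs (shiftData (Λ δ) (-w)) δ v f‖ ≤ ε * δ ^ ((1:ℝ) / 3)))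
    (hcov : ∀ (E : DiscreteDobrushin) (δ : ℝ) (w v f : Site 2), IsCorner v f →
      cornerObs (shiftData E w) δ (v + w) (f + w) = cornerObs E δ v f)
    (Λ : ℝ → DiscreteDobrushin)
    (hΩ : ∀ δ, (Λ δ).Ω = D.carrier) (hδ : ∀ δ, (Λ δ).δ = δ)
    (hadm : ∀ᶠ δ in 𝓝[>] (0:ℝ), (Λ δ).IsZdAdmissible) (K : Set ℂ) (hK : IsCompact K)
    (hKD : K ⊆ D.carrier) :
    ∀ ε > (0:ℝ), ∃ η > (0:ℝ), ∀ᶠ δ in 𝓝[>] (0:ℝ), ∀ v f v' f' : Site 2,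
      IsCorner v f → IsCorner v' f' → f - v = f' - v' → meshPoint δ v ∈ K → meshPoint δ v' ∈ K →
      dist (meshPoint δ v) (meshPoint δ v') < η →
      ‖cornerObs (Λ δ) δ v f - cornerObs (Λ δ) δ v' f'‖ ≤ ε * δ ^ ((1:ℝ) / 3) := by
  intro ε hε
  obtain ⟨η, hη, hev⟩ := hS Λ hΩ hδ hadm K hK hKD ε hε
  refine ⟨η, hη, ?_⟩
  filter_upwards [hev] with δ hδev
  intro v f v' f' hvf hv'f' hclass hvK hv'K hdist
  have e1 : v + (v' - v) = v' := by abel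
  have e2 : f + (v' - v) = f' := by
    calc f + (v' - v) = (f - v) + v' := by abel
      _ = (f' - v') + v' := by rw [hclass]
      _ = f' := sub_add_cancel f' v'
  have key : cornerObs (Λ δ) δ v' f' = cornerObs (shiftData (Λ δ) (-(v' - v))) δ v f := by
    have h := hcov (shiftData (Λ δ) (-(v' - v))) δ (v' - v) v f hvf
    rw [shiftData_shiftData_neg, e1, e2] at h
    exact h
  rw [key]
  exact hδev v f (v' - v) hvf hvK (by rw [e1]; exact hv'K) (by rw [e1]; exact hdist)

/-! ## The compositions -/

/-- **`EdgePrecompact` at the domain `D` from X1 and UFRS at `D`** (registered sub-goal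
`EdgePrecompact_at_of_X1_of_ufrsAt`): clause (i) from the thinning lemma (X1 ⇒ `UniformInnerEnvelope`) and
`boundClause`; clause (ii) from the per-domain chain and `equicontClause_at`. -/
theorem EdgePrecompact_at_of_X1_of_ufrsAt : ∀ (D : DobrushinDomain),
    (∀ ε₁ > (0:ℝ), ∃ ε' > (0:ℝ), ∀ (E : DiscreteDobrushin), E.IsZdAdmissible →
      ∀ v f : Site 2, IsCorner v f → ∀ ρ : ℝ, E.δ ≤ ρ → closedBall (meshPoint E.δ v) ρ ⊆ E.Ω →
      ∀ A : Set (BondConfig (Site 2)),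
        MeasurableSet[MeasurableSpace.comap
          (fun ω : BondConfig (Site 2) => ω \ {e | medialPoint E.δ e ∈ ball (meshPoint E.δ v) ρ})
          (inferInstance : MeasurableSpace (BondConfig (Site 2)))] A →
        (bondPercolation (zdGraph 2) half).real A ≤ ε' →
        ‖∫ ω in A, dartPhaseSum (medialExploration E ω) E.δ (1 / 3) (v, f)
          ∂(bondPercolation (zdGraph 2) half)‖ ≤ ε₁ * (E.δ / ρ) ^ ((1:ℝ) / 3)) →
    (∀ (K : Set ℂ), IsCompact K → K ⊆ D.carrier → ∀ ρ > (0:ℝ), cthickening (2 * ρ) K ⊆ D.carrier → ∀ ε > (0:ℝ), ∃ η > (0:ℝ), ∃ δ₀ > (0:ℝ), ∀ E : DiscreteDobrushin, E.Ω = D.carrier → E.IsZdAdmissible → E.δ < δ₀ → ∀ v w : Site 2, meshPoint E.δ v ∈ K → ‖meshPoint E.δ w‖ < η → (bondPercolation (zdGraph 2) half).real {ω : BondConfig (Site 2) | ¬ ∀ a a' : Site 2 × Fin 4, ((E.IsStartCorner a ∧ (shiftData E w).IsStartCorner a') ∨ (a = a' ∧ medialPoint E.δ (cSrc a) ∈ ball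 (meshPoint E.δ v) ρ ∧ medialPoint E.δ (cTgt a) ∉ ball (meshPoint E.δ v) ρ)) → ∀ n : ℕ, (∀ i < n, medialPoint E.δ (cTgt (cornerOrbit (E.bcBondConfig ω) a i)) ∉ ball (meshPoint E.δ v) ρ ∧ E.IsInnerFace (cFace (cornerOrbit (E.bcBondConfig ω) a (i + 1)))) → medialPoint E.δ (cTgt (cornerOrbit (E.bcBondConfig ω) a n)) ∈ ball (meshPoint E.δ v) ρ → ∃ n' : ℕ, (∀ i < n', medialPoint E.δ (cTgt (cornerOrbit ((shiftData E w).bcBondConfig ω) a' i)) ∉ ball (meshPoint E.δ v) ρ ∧ (shiftData E w).IsInnerFace (cFace (cornerOrbit ((shiftData E w).bcBondConfig ω) a' (i + 1)))) ∧ cornerOrbit ((shiftData E w).bcBondConfig ω) a' n' = cornerOrbit (E.bcBondConfig ω) a n ∧ ∑ i ∈ Finset.range n', turnOf ((shiftData E w).bcBondConfig ω) (cornerOrbit ((shiftData E w).bcBondConfig ω) a' i) = ∑ i ∈ Finset.range n, turnOf (E.bcBondConfig ω) (cornerOrbit (E.bcBondConfig ω) a i)} ≤ ε) →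
    ∀ (Λ : ℝ → Literature.Probability.LatticeModels.DiscreteDobrushin), (∀ δ, (Λ δ).Ω = D.carrier) → (∀ δ, (Λ δ).δ = δ) → (∀ᶠ δ in nhdsWithin (0:ℝ) (Set.Ioi 0), (Λ δ).IsZdAdmissible) → let E : ℝ → Literature.Probability.LatticeModels.Site 2 → Literature.Probability.LatticeModels.Site 2 → ℂ := fun δ v f => ∫ ω, (let γ := Literature.Probability.LatticeModels.medialExploration (Λ δ) ω; ∑ k ∈ (Finset.range γ.length).filter (fun k => γ[k]? = some (Literature.Probability.LatticeModels.cornerSource v f) ∧ γ[k + 1]? = some (Literature.Probability.LatticeModels.cornerTarget v f)), Complex.exp (-(Complex.I / 3) * ((Literature.Probability.LatticeModels.Polyline.winding ((γ.map (Literature.Probability.LatticeModels.medialPoint δ)).take (k + 2)) : ℝ) : ℂ))) ∂(Literature.Probability.Percolation.bondPercolation (Literature.Probability.LatticeModels.zdGraph 2) Literature.Probability.Percolation.half); ∀ K : Set ℂ, IsCompact K → K ⊆ D.carrier → (∃ C : ℝ, ∀ᶠ δ in nhdsWithin (0:ℝ) (Set.Ioi 0), ∀ v f : Literature.Probability.LatticeModels.Site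 2, Literature.Probability.LatticeModels.IsCorner v f → Literature.Probability.LatticeModels.meshPoint δ v ∈ K → ‖E δ v f‖ ≤ C * δ ^ ((1:ℝ) / 3)) ∧ (∀ ε > (0:ℝ), ∃ η > (0:ℝ), ∀ᶠ δ in nhdsWithin (0:ℝ) (Set.Ioi 0), ∀ v f v' f' : Literature.Probability.LatticeModels.Site 2, Literature.Probability.LatticeModels.IsCorner v f → Literature.Probability.LatticeModels.IsCorner v' f' → f - v = f' - v' → Literature.Probability.LatticeModels.meshPoint δ v ∈ K → Literature.Probability.LatticeModels.meshPoint δ v' ∈ K → dist (Literature.Probability.LatticeModels.meshPoint δ v) (Literature.Probability.LatticeModels.meshPoint δ v') < η → ‖E δ v f - E δ v' f'‖ ≤ ε * δ ^ ((1:ℝ) / 3)) := by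
  intro D hX1 hU Λ hΩ hδ hadm E K hK hKD
  have h := And.intro (boundClause_at (uniformInnerEnvelope_of_localInnerEnvelopeUI hX1) D Λ hΩ hδ hadm K hK hKD)
    (equicontClause_at D (shiftStability_at D hX1 (shiftCouplingLocality_at D (hullStability_at D
      (responseStability_at D (forwardResponseStability_at D hU))))) stub_translationCovariance Λ hΩ hδ hadm K hK hKD)
  -- buildfix 2026-08-20: `cornerObs` (CardyComplexConeDefs, rebuilt) reads FermionicObservable's `winding`, this
  -- statement's `E` the `Polyline` copy: unfold and bridge (the bridge lemma is `rfl` after the Literature dedupe).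
  simp only [cornerObs, ← Literature.Probability.LatticeModels.Polyline.winding_eq_winding'] at h
  exact h

/-- **`EdgePrecompact` for axis-parallel rectangles from X1 and `ufrs_rect`** (registered sub-goal
`EdgePrecompact_rect_of_X1_of_ufrsRect`; the second hypothesis is verbatim the registered wave-3 target `ufrs_rect`). -/
theorem EdgePrecompact_rect_of_X1_of_ufrsRect :
    (∀ ε₁ > (0:ℝ), ∃ ε' > (0:ℝ), ∀ (E : DiscreteDobrushin), E.IsZdAdmissible →
      ∀ v f : Site 2, IsCorner v f → ∀ ρ : ℝ, E.δ ≤ ρ → closedBall (meshPoint E.δ v) ρ ⊆ E.Ω →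
      ∀ A : Set (BondConfig (Site 2)),
        MeasurableSet[MeasurableSpace.comap
          (fun ω : BondConfig (Site 2) => ω \ {e | medialPoint E.δ e ∈ ball (meshPoint E.δ v) ρ})
          (inferInstance : MeasurableSpace (BondConfig (Site 2)))] A →
        (bondPercolation (zdGraph 2) half).real A ≤ ε' →
        ‖∫ ω in A, dartPhaseSum (medialExploration E ω) E.δ (1 / 3) (v, f)
          ∂(bondPercolation (zdGraph 2) half)‖ ≤ ε₁ * (E.δ / ρ) ^ ((1:ℝ) / 3)) →
    (∀ (D : DobrushinDomain), (∃ x₀ x₁ y₀ y₁ : ℝ, x₀ < x₁ ∧ y₀ < y₁ ∧ D.carrier = Set.Ioo x₀ x₁ ×ℂ Set.Ioo y₀ y₁) → ∀ (K : Set ℂ), IsCompact K → K ⊆ D.carrier → ∀ ρ > (0:ℝ), cthickening (2 * ρ) K ⊆ D.carrier → ∀ ε > (0:ℝ), ∃ η > (0:ℝ), ∃ δ₀ > (0:ℝ), ∀ E : DiscreteDobrushin, E.Ω = D.carrier → E.IsZdAdmissible → E.δ < δ₀ → ∀ v w : Site 2, meshPoint E.δ v ∈ K → ‖meshPoint E.δ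 w‖ < η → (bondPercolation (zdGraph 2) half).real {ω : BondConfig (Site 2) | ¬ ∀ a a' : Site 2 × Fin 4, ((E.IsStartCorner a ∧ (shiftData E w).IsStartCorner a') ∨ (a = a' ∧ medialPoint E.δ (cSrc a) ∈ ball (meshPoint E.δ v) ρ ∧ medialPoint E.δ (cTgt a) ∉ ball (meshPoint E.δ v) ρ)) → ∀ n : ℕ, (∀ i < n, medialPoint E.δ (cTgt (cornerOrbit (E.bcBondConfig ω) a i)) ∉ ball (meshPoint E.δ v) ρ ∧ E.IsInnerFace (cFace (cornerOrbit (E.bcBondConfig ω) a (i + 1)))) → medialPoint E.δ (cTgt (cornerOrbit (E.bcBondConfig ω) a n)) ∈ ball (meshPoint E.δ v) ρ → ∃ n' : ℕ, (∀ i < n', medialPoint E.δ (cTgt (cornerOrbit ((shiftData E w).bcBondConfig ω) a' i)) ∉ ball (meshPoint E.δ v) ρ ∧ (shiftData E w).IsInnerFace (cFace (cornerOrbit ((shiftData E w).bcBondConfig ω) a' (i + 1)))) ∧ cornerOrbit ((shiftData E w).bcBondConfig ω) a' n' = cornerOrbit (E.bcBondConfig ω) a n ∧ ∑ i ∈ Finset.range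 n', turnOf ((shiftData E w).bcBondConfig ω) (cornerOrbit ((shiftData E w).bcBondConfig ω) a' i) = ∑ i ∈ Finset.range n, turnOf (E.bcBondConfig ω) (cornerOrbit (E.bcBondConfig ω) a i)} ≤ ε) →
    ∀ (D : DobrushinDomain), (∃ x₀ x₁ y₀ y₁ : ℝ, x₀ < x₁ ∧ y₀ < y₁ ∧ D.carrier = Set.Ioo x₀ x₁ ×ℂ Set.Ioo y₀ y₁) →
    ∀ (Λ : ℝ → Literature.Probability.LatticeModels.DiscreteDobrushin), (∀ δ, (Λ δ).Ω = D.carrier) → (∀ δ, (Λ δ).δ = δ) → (∀ᶠ δ in nhdsWithin (0:ℝ) (Set.Ioi 0), (Λ δ).IsZdAdmissible) → let E : ℝ → Literature.Probability.LatticeModels.Site 2 → Literature.Probability.LatticeModels.Site 2 → ℂ := fun δ v f => ∫ ω, (let γ := Literature.Probability.LatticeModels.medialExploration (Λ δ) ω; ∑ k ∈ (Finset.range γ.length).filter (fun k => γ[k]? = some (Literature.Probability.LatticeModels.cornerSource v f) ∧ γ[k + 1]? = some (Literature.Probability.LatticeModels.cornerTarget v f)), Complex.exp (-(Complex.I / 3)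 * ((Literature.Probability.LatticeModels.Polyline.winding ((γ.map (Literature.Probability.LatticeModels.medialPoint δ)).take (k + 2)) : ℝ) : ℂ))) ∂(Literature.Probability.Percolation.bondPercolation (Literature.Probability.LatticeModels.zdGraph 2) Literature.Probability.Percolation.half); ∀ K : Set ℂ, IsCompact K → K ⊆ D.carrier → (∃ C : ℝ, ∀ᶠ δ in nhdsWithin (0:ℝ) (Set.Ioi 0), ∀ v f : Literature.Probability.LatticeModels.Site 2, Literature.Probability.LatticeModels.IsCorner v f → Literature.Probability.LatticeModels.meshPoint δ v ∈ K → ‖E δ v f‖ ≤ C * δ ^ ((1:ℝ) / 3)) ∧ (∀ ε > (0:ℝ), ∃ η > (0:ℝ), ∀ᶠ δ in nhdsWithin (0:ℝ) (Set.Ioi 0), ∀ v f v' f' : Literature.Probability.LatticeModels.Site 2, Literature.Probability.LatticeModels.IsCorner v f → Literature.Probability.LatticeModels.IsCorner v' f' → f - v = f' - v' → Literature.Probability.LatticeModels.meshPoint δ v ∈ K → Literature.Probability.LatticeModels.meshPoint δ v' ∈ K → dist (Literature.Probability.LatticeModels.meshPoint δ v) (Literature.Probability.LatticeModels.meshPoint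 δ v') < η → ‖E δ v f - E δ v' f'‖ ≤ ε * δ ^ ((1:ℝ) / 3)) :=
  fun hX1 hR D hD => EdgePrecompact_at_of_X1_of_ufrsAt D hX1 (hR D hD)

set_option linter.unusedSimpArgs false in
/-- Certificate that the per-domain conclusion above is the crux: `EdgePrecompact` is, by `Iff.rfl`, the
statement "for every Dobrushin domain `D`, the conclusion of `EdgePrecompact_at_of_X1_of_ufrsAt D`". -/
example : EdgePrecompact ↔ ∀ (D : DobrushinDomain), (∀ (Λ : ℝ → Literature.Probability.LatticeModels.DiscreteDobrushin), (∀ δ, (Λ δ).Ω = D.carrier) → (∀ δ, (Λ δ).δ = δ) → (∀ᶠ δ in nhdsWithin (0:ℝ) (Set.Ioi 0), (Λ δ).IsZdAdmissible) → let E : ℝ → Literature.Probability.LatticeModels.Site 2 → Literature.Probability.LatticeModels.Site 2 → ℂ := fun δ v f => ∫ ω, (let γ := Literature.Probability.LatticeModels.medialExploration (Λ δ) ω; ∑ k ∈ (Finset.range γ.length).filter (fun k => γ[k]? = some (Literature.Probability.LatticeModels.cornerSource v f) ∧ γ[k + 1]? = some (Literature.Probability.LatticeModels.cornerTarget v f)),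 Complex.exp (-(Complex.I / 3) * ((Literature.Probability.LatticeModels.Polyline.winding ((γ.map (Literature.Probability.LatticeModels.medialPoint δ)).take (k + 2)) : ℝ) : ℂ))) ∂(Literature.Probability.Percolation.bondPercolation (Literature.Probability.LatticeModels.zdGraph 2) Literature.Probability.Percolation.half); ∀ K : Set ℂ, IsCompact K → K ⊆ D.carrier → (∃ C : ℝ, ∀ᶠ δ in nhdsWithin (0:ℝ) (Set.Ioi 0), ∀ v f : Literature.Probability.LatticeModels.Site 2, Literature.Probability.LatticeModels.IsCorner v f → Literature.Probability.LatticeModels.meshPoint δ v ∈ K → ‖E δ v f‖ ≤ C * δ ^ ((1:ℝ) / 3)) ∧ (∀ ε > (0:ℝ), ∃ η > (0:ℝ), ∀ᶠ δ in nhdsWithin (0:ℝ) (Set.Ioi 0), ∀ v f v' f' : Literature.Probability.LatticeModels.Site 2, Literature.Probability.LatticeModels.IsCorner v f → Literature.Probability.LatticeModels.IsCorner v' f' → f - v = f' - v' → Literature.Probability.LatticeModels.meshPoint δ v ∈ K → Literature.Probability.LatticeModels.meshPoint δ v' ∈ K → dist (Literature.Probability.LatticeModels.meshPoint δ v) (Literature.Probability.LatticeModels.meshPoint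 δ v') < η → ‖E δ v f - E δ v' f'‖ ≤ ε * δ ^ ((1:ℝ) / 3))) := by
  -- buildfix 2026-08-20: this certificate spells `Polyline.winding`, the route file spells FermionicObservable's
  -- copy; until the Literature migration dedupe makes them one constant, rewrite with the bridge lemma.
  simp only [EdgePrecompact, Literature.Probability.LatticeModels.Polyline.winding_eq_winding']

end

end Summit.CriticalPhenomena.CardyFormulaZ2.Cruxes.EdgePrecompact.QkzStripBoundaryArm
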